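import Summits.QuantumFields.YangMills.Theorems.BalabanUVNodesPortU8LocUnivPackage
import Summits.QuantumFields.YangMills.Theorems.BalabanUVNodesPortU8LocUnivDecayClause1
import Summits.QuantumFields.YangMills.Theorems.BalabanUVNodesPortU8LocUnivDecayClause2
import Summits.QuantumFields.YangMills.Theorems.BalabanUVNodesK0RecordFormatNamesLemmas13

/-!
# Port piece U8 — THE SELECTOR-FREE PACKAGE WITH (‴-LocUniv) CLAUSES 1–2 DISCHARGED: ★★★ `portPieceLocalityU8_LocUniv_of_clauses34`
# (displayed inputs now: clauses 3–4 of (‴-LocUniv) — the second-difference ∕ `d*d` faces at rate η³ — and (Tok-cmpU-cap) ONLY)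

Cell `ym-nodeO-ideate` ∕ `ym-balaban-port`, porter `ymgap-nodeO-port-PTB-1` (gen 4).  JOIN-side helper for **stmt-QuantumFields-27238** (K0ᴬ), `--supports … --as helper`.
◆ CRIT-1 g35 06:54:54Z ((hL3) packaging unblocked: `C₉' := MG163 4 * periodConst (kappa163 4) 3` before `∀ ε₂₉ … ∀ a`, via ★★ DEF-1 g36 ✓p814081 `thetaFill_norm_ρ8_bV_le_one` + the
`MG163`∕`periodConst` nonnegativity); ★★★ director-ym №523∕№525 (clause 1 = «first displayed Bałaban decay token met by proved tree theorems»).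
[I] = [Balaban1987RG1], [15] = [Balaban1985Variational], [B5] = [Balaban1984PropagatorsI], [B6] = [Balaban1984PropagatorsII].

WHAT IS PROVED (kernel, sorry-free).
§1 `decayBound_weaken` — the one monotonicity step: `A·e·exp(−κt) ≤ A'·e·exp(−κ't)` for `0 ≤ A ≤ A'`, `κ' ≤ κ`, `0 ≤ e`, `0 ≤ t`.
§2 ★★ `hL3_of_clauses34` — THE FULL (‴-LocUniv) HYPOTHESIS of ✓`portPieceLocalityU8_LocUniv` ∕ ✓`response9D_LocUniv_of_tokens` (one `C₉' ≥ 0`, one `δ₉ > 0`, BEFORE all binders, four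
   clauses for `recordHrLocξ … Finset.univ a (μ, y)`) FROM its clauses 3–4 alone: clause 1 is ✓`norm_recordHrLocξ_univ_le` (g4 file 8), clause 2 is ✓`norm_recordHrLocξ_univ_shift_sub_le`
   (g4 file 9), the colour∕ε₂₉-dependence `‖ρ₈(bV a)‖` is majorised by `1` (✓`thetaFill_norm_ρ8_bV_le_one`, DEF-1 Lemmas13), and the constants are merged as
   `C₉' := max (max (MG163 4·periodConst (kappa163 4) 3) (MD163 4·periodConst (kappa163 4) 3)) C₃₄`, `δ₉ := min (kappa163 4 ∕ 4 ∕ 4) δ₃₄` (§1; the `d = 4` readings `…_four`).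
§3 ★★★ `portPieceLocalityU8_LocUniv_of_clauses34` — the selector-free U8 package (C1)ᵀ + (C2a)(C2b)ᵀ + (E4a)ᵀ of ✓`portPieceLocalityU8_LocUniv` with the displayed inputs cut down to
   clauses 3–4 + (Tok-cmpU-cap).

HONEST FRAMING.  Bookkeeping over proved tree theorems; clauses 3–4 (the η³ second-difference and `d*d` faces — [15] (190) third∕fourth lines, whose discharge needs the (2.21)
critical-point EQUATION, not kernel Hölder bounds) and (Tok-cmpU-cap) stay DISPLAYED; nothing of Bałaban's analysis asserted; K0ᴬ 27238 OPEN; NODE O 0∕1; COUNT 8∕28 · K 1∕4 UNMOVED;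
finite `𝕋⁴_{L^K}` at fixed ε — NOT continuum ∕ OS ∕ Clay; **the Yang–Mills mass gap (Clay) is NOT proved by any of this.**
-/

noncomputable section

open scoped BigOperators Matrix.Norms.L2Operator

namespace Summit.QuantumFields.YangMills.Theorems.PortU8

open Literature.MathematicalPhysics.QuantumFieldTheory.Balaban1983to89
open Literature.MathematicalPhysics.QuantumFieldTheory.Balaban1983to89.Node00
open Literature.MathematicalPhysics.QuantumFieldTheory.Balaban1983to89.T4Continuum (T4Family)
open Literature.MathematicalPhysics.QuantumFieldTheory.Balaban1983to89.B5Hk163Strip (kappa163 kappa163_pos)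
open Literature.MathematicalPhysics.QuantumFieldTheory.Balaban1983to89.B5Hk163Decay (MG163 MG163_nonneg)
open Literature.MathematicalPhysics.QuantumFieldTheory.Balaban1983to89.B5Hk163TorusHolderDecay (MD163)
open Literature.MathematicalPhysics.QuantumFieldTheory.Balaban1983to89.B4TorusKernel (periodConst)
open Literature.MathematicalPhysics.QuantumFieldTheory.Balaban1983to89.B5DPD126Uniform (periodConst_nonneg_of_pos)
open Summit.QuantumFields.YangMills.Theorems.K0RecordFormatNames

variable (F : T4Family)

/-! ## §1  One monotonicity step -/

/-- **WEAKENING A DECAY BOUND**: `A·e·exp(−κt) ≤ A'·e·exp(−κ't)` whenever `0 ≤ A ≤ A'`, `κ' ≤ κ`, `0 ≤ e`, `0 ≤ t`. [cite: Balaban1985Variational, (190) p.308 (bookkeeping)] -/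
theorem decayBound_weaken {A A' κ κ' e t : ℝ} (hA : A ≤ A') (hA0 : 0 ≤ A) (hκ : κ' ≤ κ) (he : 0 ≤ e) (ht : 0 ≤ t) :
    A * e * Real.exp (-(κ * t)) ≤ A' * e * Real.exp (-(κ' * t)) :=
  mul_le_mul (mul_le_mul_of_nonneg_right hA he) (Real.exp_le_exp.2 (by nlinarith)) (Real.exp_pos _).le (mul_nonneg (hA0.trans hA) he)

/-- Clause 1 (✓`norm_recordHrLocξ_univ_le`) with the dimension `(F.P K).d = 4` evaluated (`rfl`), so that its constant and rate are VISIBLY volume-uniform.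
[cite: Balaban1984PropagatorsI, (1.63) p.30; Balaban1985Variational, (190) p.308] -/
theorem norm_recordHrLocξ_univ_le_four (a₀ ε₂₉ : ℝ) (k K : ℕ) (a : (thetaFill F a₀ ε₂₉).ιβ) (μ : Fin (F.P K).d) (y : Site (F.P K) (k + 1)) (b : PBond (F.P K) 0) :
    letI θ := thetaFill F a₀ ε₂₉; letI := θ.instVβ₁; letI := θ.instVβ₂; letI := θ.instιβ
    ‖recordHrLocξ F θ k K Finset.univ a (μ, y) b‖ ≤
      (MG163 4 * periodConst (kappa163 4) 3 * ‖fun i i' : Fin 2 => θ.ρ8 (θ.bV a) i i'‖) * (F.P K).eta (k + 1) *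
        Real.exp (-((kappa163 4 / (((3 : ℕ) : ℝ) + 1) / 4) * (Site.tdist (coarsenTo (k + 1) b.src) y : ℝ))) :=
  norm_recordHrLocξ_univ_le F a₀ ε₂₉ k K a μ y b

/-- Clause 2 (✓`norm_recordHrLocξ_univ_shift_sub_le`) with `(F.P K).d = 4` evaluated (`rfl`). [cite: Balaban1984PropagatorsI, (1.63) p.30; Balaban1985Variational, (190) p.308] -/
theorem norm_recordHrLocξ_univ_shift_sub_le_four (a₀ ε₂₉ : ℝ) (k K : ℕ) (a : (thetaFill F a₀ ε₂₉).ιβ) (μ : Fin (F.P K).d) (y : Site (F.P K) (k + 1))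
    (b : PBond (F.P K) 0) (ν : Fin (F.P K).d) :
    letI θ := thetaFill F a₀ ε₂₉; letI := θ.instVβ₁; letI := θ.instVβ₂; letI := θ.instιβ
    ‖recordHrLocξ F θ k K Finset.univ a (μ, y) ⟨b.src.shift ν, b.dir⟩ - recordHrLocξ F θ k K Finset.univ a (μ, y) b‖ ≤
      (MD163 4 * periodConst (kappa163 4) 3 * ‖fun i i' : Fin 2 => θ.ρ8 (θ.bV a) i i'‖) * (F.P K).eta (k + 1) ^ 2 *
        Real.exp (-((kappa163 4 / (((3 : ℕ) : ℝ) + 1) / 4) * (Site.tdist (coarsenTo (k + 1) b.src) y : ℝ))) :=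
  norm_recordHrLocξ_univ_shift_sub_le F a₀ ε₂₉ k K a μ y b ν

/-! ## §2  ★★ The full (‴-LocUniv) hypothesis from its clauses 3–4 -/

/-- ★★ **(‴-LocUniv) FROM ITS CLAUSES 3–4**: the four-clause hypothesis `hL3` of ✓`portPieceLocalityU8_LocUniv` (one `C₉' ≥ 0`, one `δ₉ > 0` before all binders) follows from the
displayed clauses 3–4 (second differences and the `d*d` stencil at rate `η³`): clauses 1–2 are the PROVED ✓`norm_recordHrLocξ_univ_le` ∕ ✓`norm_recordHrLocξ_univ_shift_sub_le` with
`‖ρ₈(bV a)‖ ≤ 1` (✓`thetaFill_norm_ρ8_bV_le_one`), constants merged by `max`∕`min`.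
[cite: Balaban1985Variational, (190) p.308, Prop. 9 p.309; Balaban1984PropagatorsI, (1.63) p.30; Balaban1984PropagatorsII, (2.35) p.228; Balaban1987RG1, (4.35) p.290] -/
theorem hL3_of_clauses34 (Mc : ℕ) (a₀ : ℝ)
    (h34 : ∃ C₉' δ₉ : ℝ, 0 ≤ C₉' ∧ 0 < δ₉ ∧ ∀ (k n : ℕ) (ε₂₉ : ℝ), 0 < ε₂₉ → letI θ := thetaFill F a₀ ε₂₉; letI := θ.instVβ₁; letI := θ.instVβ₂; letI := θ.instιβ;
      ∀ (a : θ.ιβ) (μ : Fin (F.P (recordK₀ F Mc k + n)).d) (y : Site (F.P (recordK₀ F Mc k + n)) (k + 1)),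
      letI Hr : PBond (F.P (recordK₀ F Mc k + n)) 0 → Fin 2 → Fin 2 → ℂ := fun b' => recordHrLocξ F θ k (recordK₀ F Mc k + n) Finset.univ a (μ, y) b';
      ∀ b : PBond (F.P (recordK₀ F Mc k + n)) 0,
        ‖∑ ν : Fin (F.P (recordK₀ F Mc k + n)).d, (Hr ⟨b.src.shift ν, b.dir⟩ - (2 : ℂ) • Hr b + Hr ⟨b.src.unshift ν, b.dir⟩)‖ ≤
          C₉' * (F.P (recordK₀ F Mc k + n)).eta (k + 1) ^ 3 * Real.exp (-(δ₉ * (Site.tdist (coarsenTo (k + 1) b.src) y : ℝ))) ∧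
        ‖∑ ν : Fin (F.P (recordK₀ F Mc k + n)).d, ((Hr ⟨b.src, b.dir⟩ + Hr ⟨(b.src).shift b.dir, ν⟩ - Hr ⟨(b.src).shift ν, b.dir⟩ - Hr ⟨b.src, ν⟩) -
          (Hr ⟨b.src.unshift ν, b.dir⟩ + Hr ⟨(b.src.unshift ν).shift b.dir, ν⟩ - Hr ⟨(b.src.unshift ν).shift ν, b.dir⟩ - Hr ⟨b.src.unshift ν, ν⟩))‖ ≤
          C₉' * (F.P (recordK₀ F Mc k + n)).eta (k + 1) ^ 3 * Real.exp (-(δ₉ * (Site.tdist (coarsenTo (k + 1) b.src) y : ℝ)))) :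
    ∃ C₉' δ₉ : ℝ, 0 ≤ C₉' ∧ 0 < δ₉ ∧ ∀ (k n : ℕ) (ε₂₉ : ℝ), 0 < ε₂₉ → letI θ := thetaFill F a₀ ε₂₉; letI := θ.instVβ₁; letI := θ.instVβ₂; letI := θ.instιβ;
      ∀ (a : θ.ιβ) (μ : Fin (F.P (recordK₀ F Mc k + n)).d) (y : Site (F.P (recordK₀ F Mc k + n)) (k + 1)),
      letI Hr : PBond (F.P (recordK₀ F Mc k + n)) 0 → Fin 2 → Fin 2 → ℂ := fun b' => recordHrLocξ F θ k (recordK₀ F Mc k + n) Finset.univ a (μ, y) b';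
      ∀ b : PBond (F.P (recordK₀ F Mc k + n)) 0,
        ‖Hr b‖ ≤ C₉' * (F.P (recordK₀ F Mc k + n)).eta (k + 1) * Real.exp (-(δ₉ * (Site.tdist (coarsenTo (k + 1) b.src) y : ℝ))) ∧
        (∀ ν : Fin (F.P (recordK₀ F Mc k + n)).d, ‖Hr ⟨b.src.shift ν, b.dir⟩ - Hr b‖ ≤ C₉' * (F.P (recordK₀ F Mc k + n)).eta (k + 1) ^ 2 * Real.exp (-(δ₉ * (Site.tdist (coarsenTo (k + 1) b.src) y : ℝ)))) ∧
        ‖∑ ν : Fin (F.P (recordK₀ F Mc k + n)).d, (Hr ⟨b.src.shift ν, b.dir⟩ - (2 : ℂ) • Hr b + Hr ⟨b.src.unshift ν, b.dir⟩)‖ ≤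
          C₉' * (F.P (recordK₀ F Mc k + n)).eta (k + 1) ^ 3 * Real.exp (-(δ₉ * (Site.tdist (coarsenTo (k + 1) b.src) y : ℝ))) ∧
        ‖∑ ν : Fin (F.P (recordK₀ F Mc k + n)).d, ((Hr ⟨b.src, b.dir⟩ + Hr ⟨(b.src).shift b.dir, ν⟩ - Hr ⟨(b.src).shift ν, b.dir⟩ - Hr ⟨b.src, ν⟩) -
          (Hr ⟨b.src.unshift ν, b.dir⟩ + Hr ⟨(b.src.unshift ν).shift b.dir, ν⟩ - Hr ⟨(b.src.unshift ν).shift ν, b.dir⟩ - Hr ⟨b.src.unshift ν, ν⟩))‖ ≤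
          C₉' * (F.P (recordK₀ F Mc k + n)).eta (k + 1) ^ 3 * Real.exp (-(δ₉ * (Site.tdist (coarsenTo (k + 1) b.src) y : ℝ))) := by
  obtain ⟨C, δ, hC, hδ, h⟩ := h34
  -- the two proved constants (d = 4) and their common rate
  have hA₁0 : 0 ≤ MG163 4 * periodConst (kappa163 4) 3 := mul_nonneg (MG163_nonneg _) (periodConst_nonneg_of_pos (kappa163_pos _) _)
  have hA₂0 : 0 ≤ MD163 4 * periodConst (kappa163 4) 3 :=
    mul_nonneg (mul_nonneg (pow_nonneg (Real.exp_pos _).le _) (B5Hk163TorusHolderDecay.CHolder163_nonneg (0 : Fin 4) le_rfl zero_lt_one))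
      (periodConst_nonneg_of_pos (kappa163_pos _) _)
  have hκ₀0 : 0 < kappa163 4 / (((3 : ℕ) : ℝ) + 1) / 4 := div_pos (div_pos (kappa163_pos _) (by positivity)) (by norm_num)
  refine ⟨max (max (MG163 4 * periodConst (kappa163 4) 3) (MD163 4 * periodConst (kappa163 4) 3)) C, min (kappa163 4 / (((3 : ℕ) : ℝ) + 1) / 4) δ,
    hC.trans (le_max_right _ _), lt_min hκ₀0 hδ, fun k n ε₂₉ hε a μ y b => ?_⟩
  letI θ := thetaFill F a₀ ε₂₉; letI := θ.instVβ₁; letI := θ.instVβ₂; letI := θ.instιβ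
  have hR0 : 0 ≤ ‖fun i i' : Fin 2 => θ.ρ8 (θ.bV a) i i'‖ := norm_nonneg _
  have hR1 : ‖fun i i' : Fin 2 => θ.ρ8 (θ.bV a) i i'‖ ≤ 1 := thetaFill_norm_ρ8_bV_le_one F a₀ ε₂₉ a
  have hη0 : 0 ≤ (F.P (recordK₀ F Mc k + n)).eta (k + 1) := by
    unfold Params.eta; exact (pow_pos (inv_pos.2 (F.P (recordK₀ F Mc k + n)).cast_L_pos) _).le
  have ht : 0 ≤ (Site.tdist (coarsenTo (k + 1) b.src) y : ℝ) := Nat.cast_nonneg _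
  have hCmax : C ≤ max (max (MG163 4 * periodConst (kappa163 4) 3) (MD163 4 * periodConst (kappa163 4) 3)) C := le_max_right _ _
  have hδmin : min (kappa163 4 / (((3 : ℕ) : ℝ) + 1) / 4) δ ≤ δ := min_le_right _ _
  obtain ⟨h3, h4⟩ := h k n ε₂₉ hε a μ y b
  refine ⟨?_, fun ν => ?_, ?_, ?_⟩
  · -- clause 1: ✓`norm_recordHrLocξ_univ_le`, `‖ρ₈‖ ≤ 1`, weaken
    exact (norm_recordHrLocξ_univ_le_four F a₀ ε₂₉ k _ a μ y b).trans
      (decayBound_weaken ((mul_le_of_le_one_right hA₁0 hR1).trans ((le_max_left _ _).trans (le_max_left _ _))) (mul_nonneg hA₁0 hR0)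
        (min_le_left _ _) hη0 ht)
  · -- clause 2: ✓`norm_recordHrLocξ_univ_shift_sub_le`
    exact (norm_recordHrLocξ_univ_shift_sub_le_four F a₀ ε₂₉ k _ a μ y b ν).trans
      (decayBound_weaken ((mul_le_of_le_one_right hA₂0 hR1).trans ((le_max_right _ _).trans (le_max_left _ _))) (mul_nonneg hA₂0 hR0)
        (min_le_left _ _) (pow_nonneg hη0 2) ht)
  · exact h3.trans (decayBound_weaken hCmax hC hδmin (pow_nonneg hη0 3) ht)
  · exact h4.trans (decayBound_weaken hCmax hC hδmin (pow_nonneg hη0 3) ht)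

/-! ## §3  ★★★ The selector-free U8 package with clauses 1–2 discharged -/

/-- ★★★ **THE SELECTOR-FREE U8 PACKAGE ON THE TRANSVERSE TABLE, CLAUSES 1–2 OF (‴-LocUniv) DISCHARGED**: under the displayed clauses 3–4 of (‴-LocUniv) (second differences and
the `d*d` stencil of `recordHrLocξ … Finset.univ a (μ, y)` at rate `η³ e^{−δ₉·tdist}`) and (Tok-cmpU-cap), the conclusion of ✓`portPieceLocalityU8_LocUniv` verbatim: for every
`α₂ > 0` there are `C₉ ≥ 0`, `δ₀ > 0` with (C1)ᵀ `Response9DAtLocUnivξ … a Mc k (recordK₀ F Mc k) α₂ C₉ δ₀` for every colour, and per member (C2a)(C2b)ᵀ + (E4a)ᵀ hypothesis-free.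
[cite: Balaban1985Variational, Prop. 9 p.309, (190) p.308; Balaban1987RG1, (1.21) p.264, (4.4)–(4.5) pp.281–282, (4.35) p.290; Balaban1984PropagatorsI, (1.63) p.30; Balaban1984PropagatorsII, (2.5)–(2.6) p.224, (2.35) p.228] -/
theorem portPieceLocalityU8_LocUniv_of_clauses34 (Mc : ℕ) (a₀ : ℝ) (hMc : McGuard F Mc)
    (h34 : ∃ C₉' δ₉ : ℝ, 0 ≤ C₉' ∧ 0 < δ₉ ∧ ∀ (k n : ℕ) (ε₂₉ : ℝ), 0 < ε₂₉ → letI θ := thetaFill F a₀ ε₂₉; letI := θ.instVβ₁; letI := θ.instVβ₂; letI := θ.instιβ;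
      ∀ (a : θ.ιβ) (μ : Fin (F.P (recordK₀ F Mc k + n)).d) (y : Site (F.P (recordK₀ F Mc k + n)) (k + 1)),
      letI Hr : PBond (F.P (recordK₀ F Mc k + n)) 0 → Fin 2 → Fin 2 → ℂ := fun b' => recordHrLocξ F θ k (recordK₀ F Mc k + n) Finset.univ a (μ, y) b';
      ∀ b : PBond (F.P (recordK₀ F Mc k + n)) 0,
        ‖∑ ν : Fin (F.P (recordK₀ F Mc k + n)).d, (Hr ⟨b.src.shift ν, b.dir⟩ - (2 : ℂ) • Hr b + Hr ⟨b.src.unshift ν, b.dir⟩)‖ ≤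
          C₉' * (F.P (recordK₀ F Mc k + n)).eta (k + 1) ^ 3 * Real.exp (-(δ₉ * (Site.tdist (coarsenTo (k + 1) b.src) y : ℝ))) ∧
        ‖∑ ν : Fin (F.P (recordK₀ F Mc k + n)).d, ((Hr ⟨b.src, b.dir⟩ + Hr ⟨(b.src).shift b.dir, ν⟩ - Hr ⟨(b.src).shift ν, b.dir⟩ - Hr ⟨b.src, ν⟩) -
          (Hr ⟨b.src.unshift ν, b.dir⟩ + Hr ⟨(b.src.unshift ν).shift b.dir, ν⟩ - Hr ⟨(b.src.unshift ν).shift ν, b.dir⟩ - Hr ⟨b.src.unshift ν, ν⟩))‖ ≤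
          C₉' * (F.P (recordK₀ F Mc k + n)).eta (k + 1) ^ 3 * Real.exp (-(δ₉ * (Site.tdist (coarsenTo (k + 1) b.src) y : ℝ))))
    (hcmp : ∃ C₉' δ₉ : ℝ, 0 ≤ C₉' ∧ 0 < δ₉ ∧ ∀ (k n : ℕ) (ε₂₉ : ℝ), 0 < ε₂₉ → letI θ := thetaFill F a₀ ε₂₉; letI := θ.instVβ₁; letI := θ.instVβ₂; letI := θ.instιβ;
      ∀ (a : θ.ιβ) (μ : Fin (F.P (recordK₀ F Mc k + n)).d) (y : Site (F.P (recordK₀ F Mc k + n)) (k + 1)),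
      ∀ R3 R0 : ℕ, R3 + nestRadius Mc 1 ≤ R0 → 2 * (R0 + 1) < (F.P (recordK₀ F Mc k + n)).sitesPerDir (k + 1) → ∀ z₀ : Fin 4 → ℤ, y ∈ recordWindow F k (recordK₀ F Mc k + n) R3 z₀ →
      letI Hd : PBond (F.P (recordK₀ F Mc k + n)) 0 → Fin 2 → Fin 2 → ℂ := fun b' => recordHrLocξ F θ k (recordK₀ F Mc k + n) Finset.univ a (μ, y) b' -
        recordHrLocξ F θ k (recordK₀ F Mc k + n) (recordWindow F k (recordK₀ F Mc k + n) R0 z₀) a (μ, y) b';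
      ∀ b : PBond (F.P (recordK₀ F Mc k + n)) 0, coarsenTo (k + 1) b.src ∈ recordWindow F k (recordK₀ F Mc k + n) R3 z₀ →
        ‖Hd b‖ ≤ C₉' * (F.P (recordK₀ F Mc k + n)).eta (k + 1) * Real.exp (-(δ₉ * ((R0 : ℝ) - (R3 : ℝ)))) ∧
        (∀ ν : Fin (F.P (recordK₀ F Mc k + n)).d, ‖Hd ⟨b.src.shift ν, b.dir⟩ - Hd b‖ ≤ C₉' * (F.P (recordK₀ F Mc k + n)).eta (k + 1) ^ 2 * Real.exp (-(δ₉ * ((R0 : ℝ) - (R3 : ℝ))))) ∧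
        ‖∑ ν : Fin (F.P (recordK₀ F Mc k + n)).d, (Hd ⟨b.src.shift ν, b.dir⟩ - (2 : ℂ) • Hd b + Hd ⟨b.src.unshift ν, b.dir⟩)‖ ≤
          C₉' * (F.P (recordK₀ F Mc k + n)).eta (k + 1) ^ 3 * Real.exp (-(δ₉ * ((R0 : ℝ) - (R3 : ℝ)))) ∧
        ‖∑ ν : Fin (F.P (recordK₀ F Mc k + n)).d, ((Hd ⟨b.src, b.dir⟩ + Hd ⟨(b.src).shift b.dir, ν⟩ - Hd ⟨(b.src).shift ν, b.dir⟩ - Hd ⟨b.src, ν⟩) -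
          (Hd ⟨b.src.unshift ν, b.dir⟩ + Hd ⟨(b.src.unshift ν).shift b.dir, ν⟩ - Hd ⟨(b.src.unshift ν).shift ν, b.dir⟩ - Hd ⟨b.src.unshift ν, ν⟩))‖ ≤
          C₉' * (F.P (recordK₀ F Mc k + n)).eta (k + 1) ^ 3 * Real.exp (-(δ₉ * ((R0 : ℝ) - (R3 : ℝ)))))
    (α₂ : ℝ) (hα₂ : 0 < α₂) :
    ∃ C₉ δ₀ : ℝ, 0 ≤ C₉ ∧ 0 < δ₀ ∧ ∀ k : ℕ, ∀ ε₂₉ : ℝ, 0 < ε₂₉ →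
      (∀ a : (thetaFill F a₀ ε₂₉).ιβ, Response9DAtLocUnivξ F (thetaFill F a₀ ε₂₉) a Mc k (recordK₀ F Mc k) α₂ C₉ δ₀) ∧
      ∀ n : ℕ, letI θ := thetaFill F a₀ ε₂₉; letI := θ.instVβ₁; letI := θ.instVβ₂;
        (ContDiffAt ℝ 2 (recordEmbLocξ F θ k (recordK₀ F Mc k + n) Finset.univ) 0 ∧ recordEmbLocξ F θ k (recordK₀ F Mc k + n) Finset.univ 0 = 0) ∧
        ∀ a : θ.ιβ, ResponseRowAtLocξ F θ k (recordK₀ F Mc k + n) Finset.univ a :=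
  portPieceLocalityU8_LocUniv F Mc a₀ hMc (hL3_of_clauses34 F Mc a₀ h34) hcmp α₂ hα₂

end Summit.QuantumFields.YangMills.Theorems.PortU8

end
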